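import Literature.MathematicalPhysics.QuantumLattice.AnisotropicHeisenbergInfraredBound
import Literature.MathematicalPhysics.QuantumLattice.AnisotropicXYThermalInfraredBound
import Literature.MathematicalPhysics.QuantumLattice.HeisenbergOrderDLSProofs
import HarnessLib

/-!
# The infrared bound at positive temperature for the Heisenberg antiferromagnet with
# direction-dependent couplings (Kennedy–Lieb–Shastry's model (5) × Dyson–Lieb–Simon)

Topic `MathematicalPhysics/QuantumLattice`; the positive-temperature companion of
`AnisotropicHeisenbergInfraredBound.lean` (ground state, [KLS1988JSP] eqs. (6)–(7), (12)–(14) for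
the model (5)) and the antiferromagnetic companion of `AnisotropicXYThermalInfraredBound.lean`.
No named fact is introduced; everything here is a theorem.

## What is printed

Kennedy, Lieb and Shastry, J. Stat. Phys. **53** (1988) 1019–1030, p. 1020: "We also consider a
spin-1/2 model which interpolates between two and three dimensions. This model is the
three-dimensional cubic lattice with the coupling constant in two of the three lattice directions
taken to be 1, but in the third lattice direction it is taken to be `r` … For this model we prove
that there is Néel order if `1 ≥ r ≥ 0.16`. (Although we only consider the ground states of these
models, the techniques we use may be combined with the techniques of Dyson et al. for nonzero
temperatures to prove the existence of a phase transition for `1 ≥ r ≥ 0.16`.)"  The "techniques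
of Dyson et al." are [DLS1978]: Gaussian domination at positive temperature (Thm. 4.2), the
Duhamel two-point function bound (44) and the Falk–Bruch transfer (Thms. 3.1–3.2), giving the
thermal infrared bound of Thm. 6.1 with the extra term `1/(2βE_p)`; for the model (5) "the bound
(14) holds with `E_{q-Q}` replaced by `E^r_{q-Q}`" and "the double commutator (13) equals
`(2/3)[(2 - cos q₁ - cos q₂)ρ₁ + r(1 - cos q₃)ρ₃]`" (p. 1026).

This file carries out that combination at the level of the infrared bound, for every `d`, every
spin `S = n/2`, every coupling vector `K > 0`, every `β > 0` and every even side `L = 2k ≥ 4`: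
in the Gibbs state of `H_K = Σ_xΣᵢKᵢ𝐒_x·𝐒_{x+eᵢ}` (`heisAnisoTorus`), with the direction-resolved
thermal nearest-neighbour correlations `εᵢ(β) = |Λ|⁻¹Σ_z⟨S¹_zS¹_{z+eᵢ}⟩_β` (`gibbsDirBondCorr`),

`0 ≤ ĝ_q ≤ 1/(2βE^K_{q-Q}) + ½ [(-2ΣᵢKᵢ(1 - cos qᵢ)εᵢ(β)) / E^K_{q-Q}]^{1/2}`,  `q ≠ Q`

(`heisAniso_infraredBound_thermal`). Thermal Gaussian domination is the tree's theorem
`partitionFn_heisAnisoField_le` (`AnisotropicHeisenbergGaussianDomination.lean`); the transfer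
uses `Matrix.gaussianDomination_duhamel_le` ([DLS1978] (44)), `Matrix.falkBruch_sum_le_of_le`
([DLS1978] Thms. 3.1–3.2 in the weakened form `coth x ≤ 1 + 1/x`), the staggered field algebra
`heisAnisoStagGradField_cos/sin` and the double commutator `lie_lie_heisAnisoTorus` of the
ground-state file. (Isotropic check `K ≡ 1`, `εᵢ = ε`: `ĝ_q ≤ 1/(2βE_{q-Q}) + ½[2(-ε)E_q/E_{q-Q}]^{1/2}`,
the form consumed by `HeisenbergOrderNeelThermalSpinHalf.lean` in the rotated frame.)

## Contents

* **(I) isotropy at positive temperature**: `gibbsSpinCorr_anisoHeis_eq_zero_comp` — the Gibbs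
  state of `H_K` is invariant under the global quarter turns, so `⟨S^α_xS^α_y⟩_β` does not depend on
  `α`; `gibbsDirBondCorr_anisoHeis_eq_zero_comp`, `gibbsStructureFactor_anisoHeis_eq_zero_comp`;
* the thermal energy through the bond correlations: `re_gibbsState_heisAnisoTorus`
  (`Re⟨H_K⟩_{β,K'} = 3|Λ|ΣᵢKᵢεᵢ(β,K')`);
* the Gibbs expectation of the double commutator (13): `re_gibbsState_anisoHeis_lie_lie`,
  `re_gibbsState_anisoHeis_lie_lie_modes`;
* **`heisAniso_infraredBound_thermal_of_gd`** ((GDᵀ) ⇒ (IRᵀ), finite volume) and the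
  unconditional **`heisAniso_infraredBound_thermal`**;
* a-priori inputs for the sum-rule programme at `T > 0`: (T) `abs_gibbsDirBondCorr_le`
  (`|εᵢ(β)| ≤ S²`, any Hamiltonian) and (Nᵀ) the Néel energy–entropy bound
  `heisAniso_thermal_neelBound` (`ΣᵢKᵢεᵢ(β) ≤ -(S²/3)ΣᵢKᵢ + log(2S+1)/(3β)`, [DLS1978] §6 with the
  Néel trial state).

## References

* [KLS1988JSP] T. Kennedy, E. H. Lieb, B. S. Shastry, *Existence of Néel order in some spin-½
  Heisenberg antiferromagnets*, J. Stat. Phys. 53 (1988) 1019–1030, p. 1020 (the remark quoted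
  above), eqs. (5)–(7), (12)–(14), (17)–(19), p. 1026 (read in: E. H. Lieb, *Statistical Mechanics
  (Selecta)*, paper IV.7, pp. 281–290).
* [DLS1978] F. J. Dyson, E. H. Lieb, B. Simon, *Phase transitions in quantum spin systems with
  isotropic and nonisotropic interactions*, J. Stat. Phys. 18 (1978) 335–383, Thms. 3.1–3.2, 4.2,
  eq. (44), Thm. 6.1, §6 (energy–entropy bound).
* [FILS1978] J. Fröhlich, R. Israel, E. H. Lieb, B. Simon, Commun. Math. Phys. 62 (1978) 1–34,
  §3(C) (direction-dependent nearest-neighbour couplings are reflection positive).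
-/

noncomputable section

open Filter Topology Matrix Finset
open Literature.MathematicalPhysics.QuantumLattice Literature.MathematicalPhysics.QuantumLattice.SpinOperators
  Literature.Probability.LatticeModels Literature.Barriers.AtomisticToContinuum.BoseGas
open scoped ComplexOrder

namespace Literature.MathematicalPhysics.QuantumLattice

variable {d : ℕ}

/-! ### (I) The `SU(2)` symmetry of the Gibbs state of `H_K` -/

section Symmetry

variable (L : ℕ) [NeZero L] (n : ℕ) (K : Fin d → ℝ) (β : ℝ)

/-- **(Iᵀ), `1 ↔ 2`**: `⟨S²_xS²_y⟩_β = ⟨S¹_xS¹_y⟩_β` in the Gibbs state of `H_K` (invariance under the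
global quarter turn about the `3`-axis, which commutes with every `𝐒_x·𝐒_y`).
[cite: KLS1988JSP, p. 1021] [cite: DLS1978, §6] -/
theorem gibbsState_anisoHeis_corr_one_eq_zero (x y : TorusSite d L) :
    gibbsState β (heisAnisoTorus L n K) (siteSpin n x 1 * siteSpin n y 1) =
      gibbsState β (heisAnisoTorus L n K) (siteSpin n x 0 * siteSpin n y 0) := by
  set U : Op (TorusSite d L) (n + 1) :=
    productOp (fun _ : TorusSite d L => diagonal fun k : Fin (n + 1) => (-Complex.I) ^ (k : ℕ))
    with hU
  have hUU : Uᴴ * U = 1 := productOp_conjTranspose_mul fun _ => spinPhase_conjTranspose_mul n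
  have hcomm : U * heisAnisoTorus L n K = heisAnisoTorus L n K * U := by
    have h := quarterTurn_conj_heisAnisoTorus L n K
    have h2 := congrArg (· * U) h
    simp only at h2
    rw [mul_assoc, hUU, mul_one] at h2
    exact h2
  have hinv := gibbsState_conj_of_commute hcomm hUU β (siteSpin n x 1 * siteSpin n y 1)
  rw [productOp_conj_mul (fun _ => spinPhase_conjTranspose_mul n),
    quarterTurn_conj_siteSpin_one, quarterTurn_conj_siteSpin_one] at hinv
  rw [hinv]

/-- **(Iᵀ), `3 ↔ 1`**: `⟨S³_xS³_y⟩_β = ⟨S¹_xS¹_y⟩_β` in the Gibbs state of `H_K` (invariance under the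
global quarter turn about the `2`-axis). [cite: KLS1988JSP, p. 1021] [cite: DLS1978, §6] -/
theorem gibbsState_anisoHeis_corr_two_eq_zero (x y : TorusSite d L) :
    gibbsState β (heisAnisoTorus L n K) (siteSpin n x 2 * siteSpin n y 2) =
      gibbsState β (heisAnisoTorus L n K) (siteSpin n x 0 * siteSpin n y 0) := by
  obtain ⟨V, hV, hV', hVz, hVx, hVy⟩ := exists_unitary_conj_spinZ_eq_spinX n
  set U : Op (TorusSite d L) (n + 1) := productOp (fun _ : TorusSite d L => V) with hU
  have hUU : Uᴴ * U = 1 := productOp_conjTranspose_mul fun _ => hV'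
  have hcomm : U * heisAnisoTorus L n K = heisAnisoTorus L n K * U := by
    have h := yTurn_conj_heisAnisoTorus L n K hV hV' hVz hVx hVy
    have h2 := congrArg (· * U) h
    simp only at h2
    rw [mul_assoc, hUU, mul_one] at h2
    exact h2
  have hinv := gibbsState_conj_of_commute hcomm hUU β (siteSpin n x 2 * siteSpin n y 2)
  have hz : U * siteSpin n x 2 * Uᴴ = siteSpin n x 0 := by
    rw [hU, productOp_conj_siteSpin (fun _ => hV), spinVec_two, hVz]
    rfl
  have hz' : U * siteSpin n y 2 * Uᴴ = siteSpin n y 0 := by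
    rw [hU, productOp_conj_siteSpin (fun _ => hV), spinVec_two, hVz]
    rfl
  rw [hU, productOp_conj_mul (fun _ => hV'), ← hU, hz, hz'] at hinv
  rw [hinv]

/-- **(Iᵀ) Isotropy at positive temperature**: all three spin components have the same thermal
two-point function in the Gibbs state of `H_K` ([KLS1988JSP] p. 1021: "the expectation of
`S³_xS³_y` is one-third of the expectation of `𝐒_x·𝐒_y`", here for `⟨·⟩_β`).
[cite: KLS1988JSP, p. 1021] [cite: DLS1978, §6] -/
theorem gibbsSpinCorr_anisoHeis_eq_zero_comp (α : Fin 3) (x y : TorusSite d L) :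
    gibbsSpinCorr β (heisAnisoTorus L n K) α x y = gibbsSpinCorr β (heisAnisoTorus L n K) 0 x y := by
  fin_cases α
  · rfl
  · exact congrArg Complex.re (gibbsState_anisoHeis_corr_one_eq_zero L n K β x y)
  · exact congrArg Complex.re (gibbsState_anisoHeis_corr_two_eq_zero L n K β x y)

/-- Isotropy of the direction-resolved thermal bond correlations of `H_K`: `εᵢ^α(β) = εᵢ^1(β)`.
[cite: KLS1988JSP, p. 1021] -/
theorem gibbsDirBondCorr_anisoHeis_eq_zero_comp (α : Fin 3) (i : Fin d) :
    gibbsDirBondCorr β (heisAnisoTorus L n K) α i = gibbsDirBondCorr β (heisAnisoTorus L n K) 0 i := by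
  simp only [gibbsDirBondCorr, gibbsSpinCorr_anisoHeis_eq_zero_comp L n K β α]

/-- Isotropy of the thermal structure factor of `H_K`. [cite: KLS1988JSP, p. 1021] -/
theorem gibbsStructureFactor_anisoHeis_eq_zero_comp (α : Fin 3) (q : TorusSite d L) :
    gibbsStructureFactor β (heisAnisoTorus L n K) α q =
      gibbsStructureFactor β (heisAnisoTorus L n K) 0 q := by
  simp only [gibbsStructureFactor, gibbsSpinCorr_anisoHeis_eq_zero_comp L n K β α]

/-- **The thermal energy of `H_K` in the Gibbs state of `H_{K'}` through the direction-resolved bond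
correlations** (`L ≥ 3`): `Re⟨H_K⟩_{β,K'} = 3|Λ| Σᵢ Kᵢ εᵢ(β,K')` — KLS's bookkeeping
"`e'₀ = 2ρ₁ + rρ₃`" per site (p. 1026, `ρᵢ = -3εᵢ`), at positive temperature.
[cite: KLS1988JSP, p. 1026] [cite: DLS1978, §6] -/
theorem re_gibbsState_heisAnisoTorus (hL3 : 3 ≤ L) (K' : Fin d → ℝ) :
    (gibbsState β (heisAnisoTorus L n K') (heisAnisoTorus L n K)).re =
      3 * (L : ℝ) ^ d * ∑ i : Fin d, K i * gibbsDirBondCorr β (heisAnisoTorus L n K') 0 i := by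
  have hH := heisAnisoTorus_isHermitian L n K'
  have hLd : (0 : ℝ) < (L : ℝ) ^ d := by
    have : (0 : ℝ) < L := by exact_mod_cast Nat.pos_of_ne_zero (NeZero.ne L)
    positivity
  have hdot : ∀ x y : TorusSite d L,
      (gibbsState β (heisAnisoTorus L n K') (spinDot n x y)).re =
        3 * gibbsSpinCorr β (heisAnisoTorus L n K') 0 x y := by
    intro x y
    rw [spinDot, map_sum, Complex.re_sum, Fin.sum_univ_three, re_gibbsState_spinBond' β hH,
      re_gibbsState_spinBond' β hH, re_gibbsState_spinBond' β hH,
      gibbsSpinCorr_anisoHeis_eq_zero_comp L n K' β 1, gibbsSpinCorr_anisoHeis_eq_zero_comp L n K' β 2]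
    ring
  rw [heisAnisoTorus_eq_sum L n hL3 K, map_sum, Complex.re_sum]
  simp_rw [map_sum, Complex.re_sum, LinearMap.map_smul, smul_eq_mul, Complex.re_ofReal_mul, hdot]
  rw [sum_comm, mul_sum]
  refine sum_congr rfl fun i _ => ?_
  rw [gibbsDirBondCorr, ← mul_sum, ← mul_sum]
  field_simp

end Symmetry

/-! ### The Gibbs expectation of the double commutator (13) -/

section DoubleCommutator

variable (β : ℝ) (L : ℕ) [NeZero L] (n : ℕ) (K : Fin d → ℝ)

/-- The Gibbs expectation of the double commutator of `H_K` with a real wave `A = Σ a_xS¹_x`, bond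
by bond, with isotropy (Iᵀ): `Re⟨[A,[H_K,A]]⟩_β = -2 Σ_xΣᵢ Kᵢ (a_x - a_{x+eᵢ})² G¹_β(x,x+eᵢ)`
(`L ≥ 3`). [cite: KLS1988JSP, eq. (13), p. 1026] [cite: DLS1978, Thm. 3.2] -/
theorem re_gibbsState_anisoHeis_lie_lie (hL3 : 3 ≤ L) (a : TorusSite d L → ℝ) :
    (gibbsState β (heisAnisoTorus L n K)
      ⁅(∑ u : TorusSite d L, (a u : ℂ) • (siteSpin n u 0 : Op (TorusSite d L) (n + 1))),
        ⁅heisAnisoTorus L n K,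
          ∑ u : TorusSite d L, (a u : ℂ) • (siteSpin n u 0 : Op (TorusSite d L) (n + 1))⁆⁆).re =
      ∑ x : TorusSite d L, ∑ i : Fin d,
        -2 * K i * (a x - a (x + Pi.single i 1)) ^ 2 *
          gibbsSpinCorr β (heisAnisoTorus L n K) 0 x (x + Pi.single i 1) := by
  have hH := heisAnisoTorus_isHermitian L n K
  rw [lie_lie_heisAnisoTorus L n K hL3, map_sum, Complex.re_sum]
  refine sum_congr rfl fun x _ => ?_
  rw [map_sum, Complex.re_sum]
  refine sum_congr rfl fun i _ => ?_
  have hxy : x ≠ x + Pi.single i 1 := by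
    intro h
    exact single_ne_zero_of_two_le L (by omega) i (left_eq_add.1 h)
  rw [LinearMap.map_smul, smul_eq_mul, Complex.re_ofReal_mul, LinearMap.map_smul, smul_eq_mul,
    show (-(((a x : ℂ) - (a (x + Pi.single i 1) : ℂ)) ^ 2)) =
      ((-((a x - a (x + Pi.single i 1)) ^ 2) : ℝ) : ℂ) by push_cast; ring,
    Complex.re_ofReal_mul, map_add, Complex.add_re, ← spinBond_eq_mul_of_ne hxy 1,
    ← spinBond_eq_mul_of_ne hxy 2, re_gibbsState_spinBond' β hH, re_gibbsState_spinBond' β hH,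
    gibbsSpinCorr_anisoHeis_eq_zero_comp L n K β 1, gibbsSpinCorr_anisoHeis_eq_zero_comp L n K β 2]
  ring

/-- **The two modes together** (`L ≥ 3`; product form `A(HA - AH) - (HA - AH)A = [A,[H,A]]` of
the brackets, as consumed by the Falk–Bruch transfer):
`Re⟨[C_q,[H_K,C_q]]⟩_β + Re⟨[D_q,[H_K,D_q]]⟩_β = -4 Σᵢ Kᵢ (1 - cos qᵢ) Σ_z G¹_β(z, z+eᵢ)` — KLS's
"(2/3)[(2 - cos q₁ - cos q₂)ρ₁ + r(1 - cos q₃)ρ₃]" (p. 1026), per mode, finite volume, `T > 0`.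
[cite: KLS1988JSP, eq. (13), p. 1026] [cite: DLS1978, Thm. 6.1] -/
theorem re_gibbsState_anisoHeis_lie_lie_modes (hL3 : 3 ≤ L) (q : TorusSite d L) :
    (gibbsState β (heisAnisoTorus L n K) (xyCosMode L n q *
        (heisAnisoTorus L n K * xyCosMode L n q - xyCosMode L n q * heisAnisoTorus L n K) -
        (heisAnisoTorus L n K * xyCosMode L n q - xyCosMode L n q * heisAnisoTorus L n K) *
          xyCosMode L n q)).re +
      (gibbsState β (heisAnisoTorus L n K) (xySinMode L n q *
        (heisAnisoTorus L n K * xySinMode L n q - xySinMode L n q * heisAnisoTorus L n K) -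
        (heisAnisoTorus L n K * xySinMode L n q - xySinMode L n q * heisAnisoTorus L n K) *
          xySinMode L n q)).re =
      -4 * ∑ i : Fin d, K i * (1 - Real.cos (latticeMomentum L q i)) *
        ∑ z : TorusSite d L, gibbsSpinCorr β (heisAnisoTorus L n K) 0 z (z + Pi.single i 1) := by
  show (gibbsState β (heisAnisoTorus L n K)
      ⁅xyCosMode L n q, ⁅heisAnisoTorus L n K, xyCosMode L n q⁆⁆).re +
    (gibbsState β (heisAnisoTorus L n K)
      ⁅xySinMode L n q, ⁅heisAnisoTorus L n K, xySinMode L n q⁆⁆).re = _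
  rw [xyCosMode, xySinMode, re_gibbsState_anisoHeis_lie_lie β L n K hL3,
    re_gibbsState_anisoHeis_lie_lie β L n K hL3, ← sum_add_distrib, mul_sum]
  simp_rw [← sum_add_distrib]
  rw [sum_comm]
  refine sum_congr rfl fun i _ => ?_
  rw [mul_sum, mul_sum]
  refine sum_congr rfl fun z _ => ?_
  have h1 := cos_sq_add_sin_sq_torusPhase L q z
  have h2 := cos_sq_add_sin_sq_torusPhase L q (z + Pi.single i 1)
  have h3 := cos_torusPhase_sub L q z (z + Pi.single i 1)
  rw [sub_add_cancel_left, cos_torusPhase_neg_single] at h3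
  set G := gibbsSpinCorr β (heisAnisoTorus L n K) 0 z (z + Pi.single i 1)
  linear_combination (-2 * K i * G) * h1 + (-2 * K i * G) * h2 + (-4 * K i * G) * h3

end DoubleCommutator

/-! ### (GDᵀ) ⇒ the direction-resolved infrared bound at positive temperature -/

section Infrared

/-- **Thermal Gaussian domination ⇒ the direction-resolved infrared bound for the anisotropic
antiferromagnet, finite volume, every spin.** On the even torus of side `L = 2k ≥ 4`, for `β > 0`
and a dual momentum `q` with `E^K_{q-Q} > 0`: if `Z_β(H_K(h)) ≤ Z_β(H_K)` for every real staggered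
field `h` ([KLS1988JSP] (17)–(18) at `T > 0`, [DLS1978] Thm. 4.2), then `0 ≤ ĝ_q` and
`ĝ_q ≤ 1/(2βE^K_{q-Q}) + ½[(-2ΣᵢKᵢ(1 - cos qᵢ)εᵢ(β))/E^K_{q-Q}]^{1/2}`
for the thermal structure factor `ĝ_q = |Λ|⁻¹Σ_{x,y}cos q·(x-y)⟨S¹_xS¹_y⟩_β` and the direction-resolved
thermal bond correlations `εᵢ(β)` of `H_K`. Chain: the fields `t·cos(p·)`, `t·sin(p·)`, `p = q - Q`,
have `V_K = 2E^K_p C_q`, `2E^K_p D_q` (`heisAnisoStagGradField_cos/sin`), so Gaussian domination and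
`Matrix.gaussianDomination_duhamel_le` ([DLS1978] (44)) give `(C_q,C_q) + (D_q,D_q) ≤ |Λ|/(2βE^K_p)`;
the Falk–Bruch transfer `Matrix.falkBruch_sum_le_of_le` ([DLS1978] Thms. 3.1–3.2) and the double
commutator `re_gibbsState_anisoHeis_lie_lie_modes` ([KLS1988JSP] (13)) conclude.
[cite: DLS1978, Thms. 3.1–3.2, 4.2, eq. (44), Thm. 6.1] [cite: KLS1988JSP, p. 1020, eqs. (12)–(14), (17)–(19), p. 1026] -/
theorem heisAniso_infraredBound_thermal_of_gd (n k : ℕ) [NeZero (2 * k)] (hk : 2 ≤ k)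
    (K : Fin d → ℝ) {β : ℝ} (hβ : 0 < β)
    (hGD : ∀ h : TorusSite d (2 * k) → ℝ,
      (partitionFn β (heisAnisoFieldHamiltonian (2 * k) n K h)).re ≤
        (partitionFn β (heisAnisoTorus (2 * k) n K)).re)
    (q : TorusSite d (2 * k))
    (hq : 0 < NVectorAniso.anisoDispersion K (latticeMomentum (2 * k) (q - neelIndex (2 * k)))) :
    0 ≤ gibbsStructureFactor β (heisAnisoTorus (2 * k) n K) 0 q ∧
      gibbsStructureFactor β (heisAnisoTorus (2 * k) n K) 0 q ≤
        1 / (2 * β * NVectorAniso.anisoDispersion K (latticeMomentum (2 * k) (q - neelIndex (2 * k)))) +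
          1 / 2 * Real.sqrt ((-2 * ∑ i : Fin d, K i * (1 - Real.cos (latticeMomentum (2 * k) q i)) *
              gibbsDirBondCorr β (heisAnisoTorus (2 * k) n K) 0 i) /
            NVectorAniso.anisoDispersion K (latticeMomentum (2 * k) (q - neelIndex (2 * k)))) := by
  have hL3 : 3 ≤ 2 * k := by omega
  -- notation
  set H : Op (TorusSite d (2 * k)) (n + 1) := heisAnisoTorus (2 * k) n K with hH_def
  have hH : H.IsHermitian := heisAnisoTorus_isHermitian (2 * k) n K
  set Q : TorusSite d (2 * k) := neelIndex (2 * k) with hQ_def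
  set p : TorusSite d (2 * k) := q - Q with hp_def
  have hpQ : p + Q = q := sub_add_cancel q Q
  set E : ℝ := NVectorAniso.anisoDispersion K (latticeMomentum (2 * k) p) with hE_def
  have hE : 0 < E := hq
  set C : Op (TorusSite d (2 * k)) (n + 1) := xyCosMode (2 * k) n q with hC_def
  set D : Op (TorusSite d (2 * k)) (n + 1) := xySinMode (2 * k) n q with hD_def
  have hC : C.IsHermitian := xyCosMode_isHermitian (2 * k) n q
  have hD : D.IsHermitian := xySinMode_isHermitian (2 * k) n q
  have hLd : 0 < (((2 * k : ℕ) : ℝ)) ^ d := by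
    have : (0 : ℝ) < ((2 * k : ℕ) : ℝ) := by exact_mod_cast (show 0 < 2 * k by omega)
    positivity
  haveI : Nonempty (TensorIndex (TorusSite d (2 * k)) (n + 1)) := ⟨fun _ => 0⟩
  set Sg : ℝ := -2 * ∑ i : Fin d, K i * (1 - Real.cos (latticeMomentum (2 * k) q i)) *
    gibbsDirBondCorr β H 0 i with hSg_def
  -- (1) the Duhamel infrared bound `(V_K(h), V_K(h)) ≤ Q_K(h)/β` from Gaussian domination
  have hDuh : ∀ h : TorusSite d (2 * k) → ℝ,
      (duhamel β H (heisAnisoStagGradField (2 * k) n K h) (heisAnisoStagGradField (2 * k) n K h)).re ≤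
        xyAnisoFieldEnergy (2 * k) K h / β := by
    intro h
    refine gaussianDomination_duhamel_le_holds _ β hβ H (heisAnisoStagGradField (2 * k) n K h) hH
      (heisAnisoStagGradField_isHermitian (2 * k) n K h) (xyAnisoFieldEnergy (2 * k) K h) (fun t => ?_)
    have ht := hGD (t • h)
    rw [heisAnisoFieldHamiltonian_smul (2 * k) n K hL3, smul_neg, ← sub_eq_add_neg] at ht
    exact ht
  -- (2) the two modes: `(C,C) + (D,D) ≤ |Λ|/(2βE)`
  set b₀ : ℝ := (((2 * k : ℕ) : ℝ)) ^ d / (2 * β * E) with hb₀_def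
  have hb₀ : 0 ≤ b₀ := by positivity
  have hmode : ∀ {W : Op (TorusSite d (2 * k)) (n + 1)} {h : TorusSite d (2 * k) → ℝ},
      heisAnisoStagGradField (2 * k) n K h = ((2 * E : ℝ) : ℂ) • W →
        (2 * E) ^ 2 * (duhamel β H W W).re ≤ xyAnisoFieldEnergy (2 * k) K h / β := by
    intro W h hVh
    have h1 := hDuh h
    rw [hVh, duhamel_smul_smul, show ((2 * E : ℝ) : ℂ) * ((2 * E : ℝ) : ℂ) =
      (((2 * E) ^ 2 : ℝ) : ℂ) by push_cast; ring, Complex.re_ofReal_mul] at h1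
    exact h1
  -- the staggered fields of the two waves at momentum `p` are the modes at `q = p + Q`
  have hVc : heisAnisoStagGradField (2 * k) n K (fun x => Real.cos (torusPhase (2 * k) p x)) =
      ((2 * E : ℝ) : ℂ) • C := by
    have h := heisAnisoStagGradField_cos n K k p
    rw [← hQ_def, hpQ] at h
    exact h
  have hVs : heisAnisoStagGradField (2 * k) n K (fun x => Real.sin (torusPhase (2 * k) p x)) =
      ((2 * E : ℝ) : ℂ) • D := by
    have h := heisAnisoStagGradField_sin n K k p
    rw [← hQ_def, hpQ] at h
    exact h
  have hb : (duhamel β H C C).re + (duhamel β H D D).re ≤ b₀ := by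
    have h1 := hmode hVc
    have h2 := hmode hVs
    have hQ := xyAnisoFieldEnergy_cos_add_sin (2 * k) K p
    rw [← hE_def] at hQ
    have hsum : (2 * E) ^ 2 * ((duhamel β H C C).re + (duhamel β H D D).re) ≤
        2 * E * (((2 * k : ℕ) : ℝ)) ^ d / β := by
      rw [mul_add, ← hQ, add_div]
      exact add_le_add h1 h2
    rw [hb₀_def, le_div_iff₀ (by positivity)]
    rw [le_div_iff₀ hβ] at hsum
    nlinarith [hsum, hE]
  -- (3) Falk–Bruch for the pair `(C, D)`
  have hA : ∀ j : Fin 2, ((![C, D] : Fin 2 → Op (TorusSite d (2 * k)) (n + 1)) j).IsHermitian := by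
    intro j
    fin_cases j
    · exact hC
    · exact hD
  have hFB := falkBruch_sum_le_of_le hH hβ.le hA (b₀ := b₀)
    (by simpa only [Fin.sum_univ_two, Matrix.cons_val_zero, Matrix.cons_val_one] using hb)
  simp only [Fin.sum_univ_two, Matrix.cons_val_zero, Matrix.cons_val_one] at hFB
  -- (4) the two sides: `|Λ| ĝ` and the double commutator
  have hlhs : gibbsStructureFactor β H 0 q * (((2 * k : ℕ) : ℝ)) ^ d =
      (gibbsState β H (C * C)).re + (gibbsState β H (D * D)).re :=
    gibbsStructureFactor_eq_modes β H q
  set c : ℝ := (gibbsState β H (C * (H * C - C * H) - (H * C - C * H) * C)).re +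
    (gibbsState β H (D * (H * D - D * H) - (H * D - D * H) * D)).re with hc_def
  have hc0 : 0 ≤ c := add_nonneg (hH.re_gibbsState_doubleComm_nonneg hC hβ.le)
    (hH.re_gibbsState_doubleComm_nonneg hD hβ.le)
  have hceq : c = (((2 * k : ℕ) : ℝ)) ^ d * (2 * Sg) := by
    have h1 := re_gibbsState_anisoHeis_lie_lie_modes β (2 * k) n K hL3 q
    have hdir : -4 * ∑ i : Fin d, K i * (1 - Real.cos (latticeMomentum (2 * k) q i)) *
        ∑ z : TorusSite d (2 * k), gibbsSpinCorr β H 0 z (z + Pi.single i 1) =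
        (((2 * k : ℕ) : ℝ)) ^ d * (2 * Sg) := by
      rw [hSg_def, mul_sum, mul_sum, mul_sum, mul_sum]
      refine sum_congr rfl fun i _ => ?_
      rw [gibbsDirBondCorr]
      field_simp
      ring
    rw [hdir] at h1
    exact h1
  -- (5) positivity of `ĝ`
  have haC : 0 ≤ (gibbsState β H (C * C)).re := re_gibbsState_mul_self_nonneg' β hH hC
  have haD : 0 ≤ (gibbsState β H (D * D)).re := re_gibbsState_mul_self_nonneg' β hH hD
  have hg0 : 0 ≤ gibbsStructureFactor β H 0 q := by
    have h0 : 0 ≤ gibbsStructureFactor β H 0 q * (((2 * k : ℕ) : ℝ)) ^ d := by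
      rw [hlhs]; exact add_nonneg haC haD
    exact nonneg_of_mul_nonneg_left h0 hLd
  refine ⟨hg0, ?_⟩
  -- the radicand is nonnegative
  have hSg0 : 0 ≤ Sg := by
    have h2 : 0 ≤ (((2 * k : ℕ) : ℝ)) ^ d * (2 * Sg) := by rw [← hceq]; exact hc0
    nlinarith [h2, hLd]
  -- (6) assemble: `|Λ|ĝ ≤ b₀ + ½√(βb₀c) = b₀ + ½ |Λ| √(Sg/E)`
  have hsqrt : Real.sqrt (β * b₀ * c) = (((2 * k : ℕ) : ℝ)) ^ d * Real.sqrt (Sg / E) := by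
    have h1 : β * b₀ * c = ((((2 * k : ℕ) : ℝ)) ^ d) ^ 2 * (Sg / E) := by
      rw [hceq, hb₀_def]
      field_simp
    rw [h1, Real.sqrt_mul (sq_nonneg _), Real.sqrt_sq hLd.le]
  have hmain : gibbsStructureFactor β H 0 q * (((2 * k : ℕ) : ℝ)) ^ d ≤
      b₀ + 1 / 2 * ((((2 * k : ℕ) : ℝ)) ^ d * Real.sqrt (Sg / E)) := by
    rw [hlhs, ← hsqrt]
    exact hFB
  have hb₀' : b₀ = (((2 * k : ℕ) : ℝ)) ^ d * (1 / (2 * β * E)) := by rw [hb₀_def]; ring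
  rw [hb₀'] at hmain
  have hfin : gibbsStructureFactor β H 0 q * (((2 * k : ℕ) : ℝ)) ^ d ≤
      (1 / (2 * β * E) + 1 / 2 * Real.sqrt (Sg / E)) * (((2 * k : ℕ) : ℝ)) ^ d := by
    calc gibbsStructureFactor β H 0 q * (((2 * k : ℕ) : ℝ)) ^ d
        ≤ (((2 * k : ℕ) : ℝ)) ^ d * (1 / (2 * β * E)) +
            1 / 2 * ((((2 * k : ℕ) : ℝ)) ^ d * Real.sqrt (Sg / E)) := hmain
      _ = (1 / (2 * β * E) + 1 / 2 * Real.sqrt (Sg / E)) * (((2 * k : ℕ) : ℝ)) ^ d := by ring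
  exact le_of_mul_le_mul_right hfin hLd

/-- **The direction-resolved infrared bound at positive temperature for the Heisenberg
antiferromagnet with direction-dependent couplings, unconditionally** — the combination announced
on [KLS1988JSP] p. 1020 ("the techniques we use may be combined with the techniques of Dyson et al.
for nonzero temperatures"): for `K > 0` componentwise (every `d`, every spin `n/2`), every `β > 0`,
on the even torus of side `2k ≥ 4` and for every dual momentum `q ≠ Q`,
`0 ≤ ĝ_q ≤ 1/(2βE^K_{q-Q}) + ½[(-2ΣᵢKᵢ(1 - cos qᵢ)εᵢ(β))/E^K_{q-Q}]^{1/2}`,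
`E^K_q = ΣᵢKᵢ(1 - cos qᵢ)` — thermal Gaussian domination being the theorem
`partitionFn_heisAnisoField_le`. (As `β → ∞` this is the ground-state bound
`ĝ_q² E^K_{q-Q} ≤ -½ΣᵢKᵢ(1 - cos qᵢ)εᵢ` of `heisAniso_infraredBound_ground`.)
[cite: KLS1988JSP, p. 1020, eqs. (5)–(7), (12)–(14), p. 1026] [cite: DLS1978, Thms. 3.1–3.2, 4.2, 6.1] -/
theorem heisAniso_infraredBound_thermal (n k : ℕ) [NeZero (2 * k)] (hk : 2 ≤ k) {K : Fin d → ℝ}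
    (hK : ∀ i, 0 < K i) {β : ℝ} (hβ : 0 < β) (q : TorusSite d (2 * k))
    (hq : q ≠ neelIndex (2 * k)) :
    0 ≤ gibbsStructureFactor β (heisAnisoTorus (2 * k) n K) 0 q ∧
      gibbsStructureFactor β (heisAnisoTorus (2 * k) n K) 0 q ≤
        1 / (2 * β * NVectorAniso.anisoDispersion K (latticeMomentum (2 * k) (q - neelIndex (2 * k)))) +
          1 / 2 * Real.sqrt ((-2 * ∑ i : Fin d, K i * (1 - Real.cos (latticeMomentum (2 * k) q i)) *
              gibbsDirBondCorr β (heisAnisoTorus (2 * k) n K) 0 i) /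
            NVectorAniso.anisoDispersion K (latticeMomentum (2 * k) (q - neelIndex (2 * k)))) :=
  heisAniso_infraredBound_thermal_of_gd n k hk K hβ
    (fun h => partitionFn_heisAnisoField_le (2 * k) n (even_two_mul k) (by omega) hβ
      (fun i => (hK i).le) h)
    q (anisoDispersion_latticeMomentum_pos (2 * k) hK (sub_ne_zero.2 hq))

end Infrared

/-! ### A-priori inputs at positive temperature: (T) and the Néel energy–entropy bound (Nᵀ) -/

section Apriori

variable {L : ℕ} [NeZero L] {n : ℕ} (β : ℝ) {H : Op (TorusSite d L) (n + 1)}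

/-- **(T) at positive temperature**: `|εᵢ^α(β)| ≤ S²` for the direction-resolved thermal bond
correlation of any Hermitian torus Hamiltonian (`|⟨S^α_xS^α_y⟩_β| ≤ S²`, `abs_gibbsSpinCorr_le`,
averaged over sites). [cite: KLS1988JSP, p. 1023] [cite: DLS1978, §6] -/
theorem abs_gibbsDirBondCorr_le (hH : H.IsHermitian) (α : Fin 3) (i : Fin d) :
    |gibbsDirBondCorr β H α i| ≤ ((n : ℝ) / 2) ^ 2 := by
  have hLd : (0 : ℝ) < (L : ℝ) ^ d := by
    have : (0 : ℝ) < L := by exact_mod_cast Nat.pos_of_ne_zero (NeZero.ne L)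
    positivity
  have hcard : (Fintype.card (TorusSite d L) : ℝ) = (L : ℝ) ^ d := by
    rw [Fintype.card_pi, prod_const, ZMod.card, card_univ, Fintype.card_fin]; push_cast; ring
  rw [gibbsDirBondCorr, abs_div, abs_of_pos hLd, div_le_iff₀ hLd]
  calc |∑ x : TorusSite d L, gibbsSpinCorr β H α x (x + Pi.single i 1)|
      ≤ ∑ x : TorusSite d L, |gibbsSpinCorr β H α x (x + Pi.single i 1)| := abs_sum_le_sum_abs _ _
    _ ≤ ∑ _x : TorusSite d L, ((n : ℝ) / 2) ^ 2 := sum_le_sum fun x _ => abs_gibbsSpinCorr_le β hH α _ _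
    _ = ((n : ℝ) / 2) ^ 2 * (L : ℝ) ^ d := by rw [sum_const, card_univ, nsmul_eq_mul, hcard, mul_comm]

end Apriori

section NeelBound

variable (k : ℕ) [NeZero (2 * k)] (n : ℕ)

/-- **(Nᵀ) The Néel energy–entropy bound for direction-dependent couplings** ([DLS1978] §6, the
constant `D`, with the Néel trial state of [KLS1988JSP] after eq. (4); the `T > 0` form of the
"Néel bound" of p. 1023): on the even torus of side `2k ≥ 4`, for every `β > 0`,
`Σᵢ Kᵢ εᵢ(β) ≤ -(S²/3) Σᵢ Kᵢ + log(n+1)/(3β)` (`S = n/2`): indeed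
`3|Λ|ΣᵢKᵢεᵢ(β) = Re⟨H_K⟩_β ≤ ⟨Néel|H_K|Néel⟩ + log(dim)/β = -S²|Λ|ΣᵢKᵢ + |Λ|log(n+1)/β`.
[cite: DLS1978, §6] [cite: KLS1988JSP, after eq. (4), p. 1023] -/
theorem heisAniso_thermal_neelBound (hL3 : 3 ≤ 2 * k) (K : Fin d → ℝ) {β : ℝ} (hβ : 0 < β) :
    ∑ i, K i * gibbsDirBondCorr β (heisAnisoTorus (2 * k) n K) 0 i ≤
      -(((n : ℝ) / 2) ^ 2 / 3) * ∑ i, K i + Real.log (n + 1) / (3 * β) := by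
  set L := 2 * k with hLdef
  have hLd : (0 : ℝ) < ((L : ℕ) : ℝ) ^ d := by
    have : (0 : ℝ) < ((L : ℕ) : ℝ) := by exact_mod_cast (show 0 < L by omega)
    positivity
  have hcardC : (Fintype.card (TorusSite d L) : ℂ) = ((L : ℕ) : ℂ) ^ d := by
    rw [Fintype.card_pi, prod_const, ZMod.card, card_univ, Fintype.card_fin]
    push_cast
    ring
  have hcard : (Fintype.card (TorusSite d L) : ℝ) = ((L : ℕ) : ℝ) ^ d := by
    rw [Fintype.card_pi, prod_const, ZMod.card, card_univ, Fintype.card_fin]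
    push_cast
    ring
  set H := heisAnisoTorus L n K with hH
  have hHerm : H.IsHermitian := heisAnisoTorus_isHermitian L n K
  -- (1) the thermal energy through the bond correlations
  have h1 : (gibbsState β H H).re =
      3 * ((L : ℕ) : ℝ) ^ d * ∑ i, K i * gibbsDirBondCorr β H 0 i :=
    re_gibbsState_heisAnisoTorus L n K β hL3 K
  -- (2) the Néel configuration and its energy
  set ε : TorusSite d L → ZMod 2 := fun x =>
    ∑ j, ZMod.castHom (dvd_mul_right 2 k) (ZMod 2) (x j) with hε
  set σN : TensorIndex (TorusSite d L) (n + 1) := fun x => if ε x = 0 then 0 else Fin.last n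
    with hσN
  have h01 : ∀ t : ZMod 2, t = 0 ∨ t = 1 := by decide
  have key : ∀ (x' : TorusSite d L) (i : Fin d),
      (σN x' = 0 ∧ σN (x' + Pi.single i 1) = Fin.last n ∨
        σN x' = Fin.last n ∧ σN (x' + Pi.single i 1) = 0) := by
    intro x' i
    have hpar : ε (x' + Pi.single i 1) = ε x' + 1 := torusParity_add_single k x' i
    simp only [hσN, hpar]
    rcases h01 (ε x') with h0 | h1'
    · left
      rw [if_pos h0, if_neg (by rw [h0]; decide)]
      exact ⟨rfl, rfl⟩
    · right
      rw [if_neg (by rw [h1']; decide), if_pos (by rw [h1']; decide)]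
      exact ⟨rfl, rfl⟩
  have h2 : H σN σN = -((((n : ℂ) / 2) ^ 2) * ((L : ℕ) : ℂ) ^ d * ∑ i, ((K i : ℝ) : ℂ)) := by
    rw [hH, heisAnisoTorus_eq_sum L n hL3 K, Matrix.sum_apply]
    simp_rw [Matrix.sum_apply, Matrix.smul_apply, smul_eq_mul]
    have hne : ∀ (x : TorusSite d L) (i : Fin d), x ≠ x + Pi.single i 1 := fun x i h => by
      have hpar := torusParity_add_single k x i
      rw [← h] at hpar
      exact absurd (add_left_cancel ((add_zero _).trans hpar)) (by decide)
    have hx : ∀ (x : TorusSite d L) (i : Fin d),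
        ((K i : ℝ) : ℂ) * spinDot n x (x + Pi.single i 1) σN σN =
          ((K i : ℝ) : ℂ) * (-(((n : ℂ) / 2) ^ 2)) := by
      intro x i
      rw [spinDot_apply_neel n (hne x i) σN (key x i)]
    simp_rw [hx]
    rw [sum_const, card_univ, nsmul_eq_mul, hcardC, ← sum_mul]
    ring
  -- (3) the energy–entropy bound against the Néel basis vector
  set v : TensorIndex (TorusSite d L) (n + 1) → ℂ := Pi.single σN 1 with hv
  have hstar : star v = v := by rw [hv, ← Pi.single_star, star_one]
  have hψ : star v ⬝ᵥ v = 1 := by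
    rw [hstar, hv, single_dotProduct, Pi.single_eq_same, one_mul]
  have h3 := Matrix.re_gibbsState_hamiltonian_le_rayleigh hHerm hβ v hψ
  rw [h1, hstar, hv, single_dotProduct, one_mul, mulVec_single_one, Matrix.col_apply, h2,
    log_card_tensorIndex', hcard, Complex.neg_re,
    show (((n : ℂ) / 2) ^ 2 * ((L : ℕ) : ℂ) ^ d * ∑ i, ((K i : ℝ) : ℂ)) =
      ((((n : ℝ) / 2) ^ 2 * ((L : ℕ) : ℝ) ^ d * ∑ i, K i : ℝ) : ℂ) by push_cast; ring,
    Complex.ofReal_re] at h3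
  -- divide by `3 L^d`
  have h4 : ((L : ℕ) : ℝ) ^ d * (3 * ∑ i, K i * gibbsDirBondCorr β H 0 i) ≤
      ((L : ℕ) : ℝ) ^ d * (-(((n : ℝ) / 2) ^ 2) * ∑ i, K i + Real.log (n + 1) / β) := by
    have : ((L : ℕ) : ℝ) ^ d * Real.log (n + 1) / β =
        ((L : ℕ) : ℝ) ^ d * (Real.log (n + 1) / β) := by ring
    linarith
  have h5 := le_of_mul_le_mul_left h4 hLd
  have h6 : ∑ i, K i * gibbsDirBondCorr β H 0 i ≤
      (-(((n : ℝ) / 2) ^ 2) * ∑ i, K i + Real.log (n + 1) / β) / 3 := by linarith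
  refine h6.trans (le_of_eq ?_)
  field_simp

end NeelBound

end Literature.MathematicalPhysics.QuantumLattice
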